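import Mathlib
import Summits.ValiantsHypothesis.ValiantsHypothesis.Theorems.MonotoneRestorationOrbitRestorationQPLinearSubalgebra
import Summits.ValiantsHypothesis.ValiantsHypothesis.Theorems.MonotoneRestorationOrbitRestorationQPStableForms
import HarnessLib

/-!
# The row/column dichotomy for stable spaces of affine forms; sub-quadratic depth-three representations (ORBIT currency)

Route MonotoneRestoration, crux `OrbitRestorationQP` (stmt-ValiantsHypothesis-18293), line `depth-three-rung`, registered stub
`stub_sigmaPiSigmaValue` (A_∞: matrix-symmetric families with polynomial-size `ΣΠΣ` circuits are quasi-polynomially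
orbit-restorable).  Namespace `Summit.ValiantsHypothesis.ValiantsHypothesis.Theorems.RowColumnDichotomy`.  Route-independent
(no `Theses` import), definition-free.

The rung asks for equivariance to be CREATED from a small, a priori asymmetric, depth-three representation.  This file isolates the
first regime in which it is created for free, by representation theory of `Sym_n × Sym_n` on the linear forms of the `n × n`
matrix (`(1 ⊕ S) ⊠ (1 ⊕ S)`, multiplicity-free), proved here ELEMENTARILY by double differencing:

* `dichotomy` — a subspace `W` of polynomials of total degree `≤ 1`, stable under INDEPENDENT row and column permutations
  `x_pq ↦ x_{σ p, τ q}`, either has all DOUBLE DIFFERENCES of linear coefficients zero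
  (`c_{ab} − c_{a'b} − c_{ab'} + c_{a'b'} = 0` for every `w ∈ W`), or contains every double-difference form
  `x_{ab} − x_{a'b} − x_{ab'} + x_{a'b'}` (`a ≠ a'`, `b ≠ b'`);
* coefficient bookkeeping for the renaming `x_pq ↦ x_{σ p, τ q}`, the row sums `r_i = Σ_j x_ij`, the column sums
  `c_j = Σ_i x_ij` and the double-difference forms.

The consequences (first case `⊆ span(1, r_i, c_j)`, second case `dim ≥ (n−1)² + 1`, the ESSENTIAL-VARIABLE DICHOTOMY for
matrix-symmetric polynomials and the SUB-QUADRATIC DEPTH-THREE STRATUM of A_∞) are in the companion file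
`Theorems/MonotoneRestorationOrbitRestorationQPRowColumnEssential.lean`.

Calibration: elementary linear algebra (folklore representation theory of `Sym_n × Sym_n`); the stratum is unconditional and
VH-free; the orbit-restorability of `ℂ[r, c] ∩ (matrix-symmetric)` with an absolute constant is the follow-up file.  Nothing here
bears on VP ≠ VNP. [folklore]

## References
* A. Dawar, G. Wilsenach, *Symmetric arithmetic circuits*, ToC 21 (2025), §3.3. [DawarWilsenach2025]
* N. Saxena, C. Seshadhri, *From Sylvester–Gallai configurations to rank bounds*, J. ACM 60 (2013). [SaxenaSeshadhri2013]
-/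

noncomputable section

open scoped Classical

-- `Summit.ValiantsHypothesis.ValiantsHypothesis.…` is the tree's single-conjunct layout (Sub = Summit).
set_option linter.dupNamespace false

namespace Summit.ValiantsHypothesis.ValiantsHypothesis.Theorems

namespace RowColumnDichotomy

open MvPolynomial Equiv

variable {n : ℕ}

/-! ### Coefficients under independent row and column renaming -/

/-- The map `(p, q) ↦ (σ p, τ q)` is injective. [folklore] -/
theorem prodMap_injective (σ τ : Perm (Fin n)) :
    Function.Injective (fun q : Fin n × Fin n => (σ q.1, τ q.2)) := by
  intro x y h
  simp only [Prod.mk.injEq] at h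
  exact Prod.ext (σ.injective h.1) (τ.injective h.2)

/-- The coefficient of `x_P` in `x_pq ↦ x_{σ p, τ q}` applied to `w` is the coefficient of `x_{(σ⁻¹ P.1, τ⁻¹ P.2)}` in `w`.
[folklore] -/
theorem coeff_single_rename₂ (σ τ : Perm (Fin n)) (w : MvPolynomial (Fin n × Fin n) ℂ) (P : Fin n × Fin n) :
    coeff (Finsupp.single P 1) (rename (fun q : Fin n × Fin n => (σ q.1, τ q.2)) w) =
      coeff (Finsupp.single (σ⁻¹ P.1, τ⁻¹ P.2) 1) w := by
  have h := coeff_rename_mapDomain (fun q : Fin n × Fin n => (σ q.1, τ q.2)) (prodMap_injective σ τ) w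
    (Finsupp.single (σ⁻¹ P.1, τ⁻¹ P.2) 1)
  rw [Finsupp.mapDomain_single] at h
  simpa only [Perm.coe_inv, Equiv.apply_symm_apply, Prod.mk.eta] using h

/-- The constant coefficient is unchanged by renaming. [folklore] -/
theorem coeff_zero_rename₂ (σ τ : Perm (Fin n)) (w : MvPolynomial (Fin n × Fin n) ℂ) :
    coeff 0 (rename (fun q : Fin n × Fin n => (σ q.1, τ q.2)) w) = coeff 0 w := by
  have h := coeff_rename_mapDomain (fun q : Fin n × Fin n => (σ q.1, τ q.2)) (prodMap_injective σ τ) w 0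
  rwa [Finsupp.mapDomain_zero] at h

/-- The coefficient of `x_P` in the variable `x_Q`. [folklore] -/
theorem coeff_single_X (P Q : Fin n × Fin n) :
    coeff (Finsupp.single P 1) (X Q : MvPolynomial (Fin n × Fin n) ℂ) = if P = Q then 1 else 0 := by
  by_cases h : P = Q
  · rw [if_pos h, h, coeff_X_same]
  · rw [if_neg h, coeff_X, if_neg]
    intro h'
    exact h ((Finsupp.single_left_inj one_ne_zero).1 h').symm

/-- The coefficient of `x_P` in a constant is `0`. [folklore] -/
theorem coeff_single_C (P : Fin n × Fin n) (a : ℂ) :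
    coeff (Finsupp.single P 1) (C a : MvPolynomial (Fin n × Fin n) ℂ) = 0 := by
  rw [coeff_C, if_neg]
  exact (Finsupp.single_ne_zero.2 one_ne_zero).symm

/-- The coefficient of `x_P` in the row sum `r_i = Σ_j x_ij`. [folklore] -/
theorem coeff_single_rowSum (P : Fin n × Fin n) (i : Fin n) :
    coeff (Finsupp.single P 1) (∑ j : Fin n, (X (i, j) : MvPolynomial (Fin n × Fin n) ℂ)) =
      if P.1 = i then 1 else 0 := by
  rw [coeff_sum]
  simp only [coeff_single_X]
  by_cases h : P.1 = i
  · rw [if_pos h, Finset.sum_eq_single P.2]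
    · rw [if_pos (show P = (i, P.2) from Prod.ext h rfl)]
    · intro j _ hj
      rw [if_neg]
      intro hP
      exact hj (by rw [hP])
    · intro hP
      exact absurd (Finset.mem_univ _) hP
  · rw [if_neg h]
    exact Finset.sum_eq_zero fun j _ => if_neg fun hP => h (by rw [hP])

/-- The coefficient of `x_P` in the column sum `c_j = Σ_i x_ij`. [folklore] -/
theorem coeff_single_colSum (P : Fin n × Fin n) (j : Fin n) :
    coeff (Finsupp.single P 1) (∑ i : Fin n, (X (i, j) : MvPolynomial (Fin n × Fin n) ℂ)) =
      if P.2 = j then 1 else 0 := by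
  rw [coeff_sum]
  simp only [coeff_single_X]
  by_cases h : P.2 = j
  · rw [if_pos h, Finset.sum_eq_single P.1]
    · rw [if_pos (show P = (P.1, j) from Prod.ext rfl h)]
    · intro i _ hi
      rw [if_neg]
      intro hP
      exact hi (by rw [hP])
    · intro hP
      exact absurd (Finset.mem_univ _) hP
  · rw [if_neg h]
    exact Finset.sum_eq_zero fun i _ => if_neg fun hP => h (by rw [hP])

/-- The double-difference form `x_ab − x_a'b − x_ab' + x_a'b'` has total degree `≤ 1`. [folklore] -/
theorem totalDegree_ddiff_le (a a' b b' : Fin n) :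
    (X (a, b) - X (a', b) - X (a, b') + X (a', b') : MvPolynomial (Fin n × Fin n) ℂ).totalDegree ≤ 1 := by
  have hX : ∀ Q : Fin n × Fin n, (X Q : MvPolynomial (Fin n × Fin n) ℂ).totalDegree ≤ 1 := fun Q => by
    rw [totalDegree_X]
  refine (totalDegree_add _ _).trans (max_le ?_ (hX _))
  refine (totalDegree_sub _ _).trans (max_le ?_ (hX _))
  exact (totalDegree_sub _ _).trans (max_le (hX _) (hX _))

/-- Renaming a double-difference form by `(σ, τ)`. [folklore] -/
theorem rename₂_ddiff (σ τ : Perm (Fin n)) (a a' b b' : Fin n) :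
    rename (fun q : Fin n × Fin n => (σ q.1, τ q.2))
        (X (a, b) - X (a', b) - X (a, b') + X (a', b') : MvPolynomial (Fin n × Fin n) ℂ) =
      X (σ a, τ b) - X (σ a', τ b) - X (σ a, τ b') + X (σ a', τ b') := by
  simp only [map_add, map_sub, rename_X]

/-! ### The dichotomy -/

/-- **THE ROW/COLUMN DICHOTOMY.**  Let `W` be a subspace of polynomials of total degree `≤ 1` on the `n × n` matrix, stable under
independent row and column permutations.  Either every `w ∈ W` has all double differences of linear coefficients equal to zero, or
`W` contains every double-difference form `x_ab − x_a'b − x_ab' + x_a'b'` (`a ≠ a'`, `b ≠ b'`). [folklore] -/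
theorem dichotomy (W : Submodule ℂ (MvPolynomial (Fin n × Fin n) ℂ))
    (hdeg : ∀ w ∈ W, MvPolynomial.totalDegree w ≤ 1)
    (hstab : ∀ (σ τ : Perm (Fin n)) (w : MvPolynomial (Fin n × Fin n) ℂ), w ∈ W →
      rename (fun q : Fin n × Fin n => (σ q.1, τ q.2)) w ∈ W) :
    (∀ w ∈ W, ∀ a a' b b' : Fin n,
        coeff (Finsupp.single (a, b) 1) w - coeff (Finsupp.single (a', b) 1) w -
          coeff (Finsupp.single (a, b') 1) w + coeff (Finsupp.single (a', b') 1) w = 0) ∨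
      (∀ a a' b b' : Fin n, a ≠ a' → b ≠ b' →
        (X (a, b) - X (a', b) - X (a, b') + X (a', b') : MvPolynomial (Fin n × Fin n) ℂ) ∈ W) := by
  by_cases hall : ∀ w ∈ W, ∀ a a' b b' : Fin n,
      coeff (Finsupp.single (a, b) 1) w - coeff (Finsupp.single (a', b) 1) w -
        coeff (Finsupp.single (a, b') 1) w + coeff (Finsupp.single (a', b') 1) w = 0
  · exact Or.inl hall
  right
  push Not at hall
  obtain ⟨w, hw, a, a', b, b', hδ⟩ := hall
  -- notation for the linear coefficients of `w` and the nonzero double difference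
  set c : Fin n × Fin n → ℂ := fun Q => coeff (Finsupp.single Q 1) w with hc
  set δ : ℂ := c (a, b) - c (a', b) - c (a, b') + c (a', b') with hδdef
  have hδ0 : δ ≠ 0 := hδ
  have ha : a ≠ a' := by
    rintro rfl; exact hδ0 (by rw [hδdef]; ring)
  have hb : b ≠ b' := by
    rintro rfl; exact hδ0 (by rw [hδdef]; ring)
  -- the doubly differenced element of `W`
  set s : Perm (Fin n) := swap a a' with hs
  set t : Perm (Fin n) := swap b b' with ht
  set v : MvPolynomial (Fin n × Fin n) ℂ :=
    w - rename (fun q : Fin n × Fin n => (s q.1, (1 : Perm (Fin n)) q.2)) w -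
      rename (fun q : Fin n × Fin n => ((1 : Perm (Fin n)) q.1, t q.2)) w +
      rename (fun q : Fin n × Fin n => (s q.1, t q.2)) w with hv
  have hvW : v ∈ W :=
    W.add_mem (W.sub_mem (W.sub_mem hw (hstab s 1 w hw)) (hstab 1 t w hw)) (hstab s t w hw)
  set E : MvPolynomial (Fin n × Fin n) ℂ := X (a, b) - X (a', b) - X (a, b') + X (a', b') with hE
  -- `v = δ • E`, by comparing coefficients
  have hvE : v = C δ * E := by
    rw [← sub_eq_zero]
    refine StableForms.eq_zero_of_coeffs ?_ ?_ ?_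
    · refine (totalDegree_sub _ _).trans (max_le (hdeg v hvW) ?_)
      refine (totalDegree_mul _ _).trans ?_
      rw [totalDegree_C, zero_add, hE]
      exact totalDegree_ddiff_le a a' b b'
    · rw [coeff_sub, hv, coeff_add, coeff_sub, coeff_sub, coeff_zero_rename₂, coeff_zero_rename₂, coeff_zero_rename₂,
        coeff_C_mul, hE, coeff_add, coeff_sub, coeff_sub, coeff_zero_X, coeff_zero_X, coeff_zero_X, coeff_zero_X]
      ring
    · rintro ⟨i, j⟩
      rw [coeff_sub, hv, coeff_add, coeff_sub, coeff_sub, coeff_single_rename₂, coeff_single_rename₂,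
        coeff_single_rename₂, coeff_C_mul, hE, coeff_add, coeff_sub, coeff_sub, coeff_single_X, coeff_single_X,
        coeff_single_X, coeff_single_X]
      simp only [inv_one, Perm.coe_one, id_eq, hs, ht, swap_inv]
      rcases eq_or_ne i a with hia | hia
      · rw [hia, swap_apply_left]
        rcases eq_or_ne j b with hjb | hjb
        · rw [hjb, swap_apply_left, if_pos rfl, if_neg (fun h => ha (Prod.ext_iff.1 h).1),
            if_neg (fun h => hb (Prod.ext_iff.1 h).2), if_neg (fun h => ha (Prod.ext_iff.1 h).1), hδdef]
          ring
        rcases eq_or_ne j b' with hjb' | hjb'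
        · rw [hjb', swap_apply_right, if_neg (fun h => hb (Prod.ext_iff.1 h).2.symm),
            if_neg (fun h => ha (Prod.ext_iff.1 h).1), if_pos rfl, if_neg (fun h => ha (Prod.ext_iff.1 h).1), hδdef]
          ring
        · rw [swap_apply_of_ne_of_ne hjb hjb', if_neg (fun h => hjb (Prod.ext_iff.1 h).2),
            if_neg (fun h => hjb (Prod.ext_iff.1 h).2), if_neg (fun h => hjb' (Prod.ext_iff.1 h).2),
            if_neg (fun h => hjb' (Prod.ext_iff.1 h).2)]
          ring
      rcases eq_or_ne i a' with hia' | hia'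
      · rw [hia', swap_apply_right]
        rcases eq_or_ne j b with hjb | hjb
        · rw [hjb, swap_apply_left, if_neg (fun h => ha (Prod.ext_iff.1 h).1.symm), if_pos rfl,
            if_neg (fun h => ha (Prod.ext_iff.1 h).1.symm), if_neg (fun h => hb (Prod.ext_iff.1 h).2), hδdef]
          ring
        rcases eq_or_ne j b' with hjb' | hjb'
        · rw [hjb', swap_apply_right, if_neg (fun h => ha (Prod.ext_iff.1 h).1.symm),
            if_neg (fun h => hb (Prod.ext_iff.1 h).2.symm), if_neg (fun h => ha (Prod.ext_iff.1 h).1.symm), if_pos rfl,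
            hδdef]
          ring
        · rw [swap_apply_of_ne_of_ne hjb hjb', if_neg (fun h => hjb (Prod.ext_iff.1 h).2),
            if_neg (fun h => hjb (Prod.ext_iff.1 h).2), if_neg (fun h => hjb' (Prod.ext_iff.1 h).2),
            if_neg (fun h => hjb' (Prod.ext_iff.1 h).2)]
          ring
      · rw [swap_apply_of_ne_of_ne hia hia', if_neg (fun h => hia (Prod.ext_iff.1 h).1),
          if_neg (fun h => hia' (Prod.ext_iff.1 h).1), if_neg (fun h => hia (Prod.ext_iff.1 h).1),
          if_neg (fun h => hia' (Prod.ext_iff.1 h).1)]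
        ring
  -- hence `E ∈ W`
  have hEW : E ∈ W := by
    have : C δ⁻¹ * v ∈ W := by
      rw [← smul_eq_C_mul]; exact W.smul_mem _ hvW
    rwa [hvE, ← mul_assoc, ← map_mul, inv_mul_cancel₀ hδ0, C_1, one_mul] at this
  -- and all its translates
  intro d d' e e' hd he
  -- permutations carrying `(a, a')` to `(d, d')` and `(b, b')` to `(e, e')`
  have hperm : ∀ x x' y y' : Fin n, x ≠ x' → y ≠ y' → ∃ σ : Perm (Fin n), σ x = y ∧ σ x' = y' := by
    intro x x' y y' hx hy
    let f : Fin n → Fin n := fun z => if z = x then y else y'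
    have hf : Set.InjOn f ({x, x'} : Finset (Fin n)) := by
      intro z hz z' hz' hzz'
      simp only [Finset.coe_insert, Finset.coe_singleton, Set.mem_insert_iff, Set.mem_singleton_iff] at hz hz'
      rcases hz with rfl | rfl <;> rcases hz' with rfl | rfl
      · rfl
      · simp only [f, if_pos rfl, if_neg (Ne.symm hx)] at hzz'; exact absurd hzz' hy
      · simp only [f, if_pos rfl, if_neg (Ne.symm hx)] at hzz'; exact absurd hzz'.symm hy
      · rfl
    obtain ⟨σ, hσ⟩ := StableForms.exists_perm_extend hf
    refine ⟨σ, ?_, ?_⟩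
    · rw [hσ x (by simp)]; simp [f]
    · rw [hσ x' (by simp)]; simp [f, Ne.symm hx]
  obtain ⟨σ, hσ1, hσ2⟩ := hperm a a' d d' ha hd
  obtain ⟨τ, hτ1, hτ2⟩ := hperm b b' e e' hb he
  have h := hstab σ τ E hEW
  rw [hE, rename₂_ddiff, hσ1, hσ2, hτ1, hτ2] at h
  exact h

end RowColumnDichotomy

end Summit.ValiantsHypothesis.ValiantsHypothesis.Theorems

end
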